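import Summits.AnomalousDissipation.AnomalousDissipation.Theses.BaireTransfer
import Literature.Analysis.FluidPDE.LerayProjectorTorusProofs
import Literature.Analysis.FluidPDE.NSGalerkinFourier

/-!
# `BaireTransfer.BaireStep` (stmt-AnomalousDissipation-1148): the Baire step of route BaireTransfer

`BaireTarget → CoherentThesis`: from budgets `E`, `ε > 0`, a finite frequency set `S` and a non-empty open
set `U` of coefficient vectors in the complete (hence Baire) parameter space `P_S = (↥S → ℂ³)` in which,
at every level `j`, the robustly loud set `interior LOUD_j` is dense, ONE coefficient vector `c ∈ U` lies in
every `LOUD_j` (Baire–Osgood: the sets `D_j := interior LOUD_j ∪ (closure U)ᶜ` are open and dense, so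
`⋂ⱼ D_j` is dense and meets `U`).  The fixed steady trigonometric-polynomial force
`f_c = realTrigPoly S (k ↦ P_k ĉ_k)` is smooth, divergence free (the Leray multiplier is transversal) and
mean zero (its zero mode is `P_0 = 0`), and the witnesses `ν_j ∈ (0, 1/(j+1))`, `τ_j`, `u_j`, `p_j` read
off `c ∈ LOUD_j` give the thesis of route CoherentStates verbatim (`ν_j → 0` by squeezing).

References: Mathlib `Topology/Baire` (`dense_iInter_of_isOpen_nat`, `Dense.inter_open_nonempty`); the
countable-intersection transfer device of B. Simon, *Operators with singular continuous spectrum I*,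
Ann. Math. 141 (1995); Foias–Temam (1976/77) for the generic-force context.  Route file
`Theses/BaireTransfer.lean`, item stmt-AnomalousDissipation-1148.
-/

-- `Summit.<Summit>.<Problem>` is the tree's mandated summit-side namespace (CONVENTIONS §2); for this
-- single-conjunct summit the two coincide, so the duplicate is deliberate.
set_option linter.dupNamespace false

noncomputable section

open scoped Topology
open Filter Set Function TopologicalSpace MeasureTheory

namespace Summit.AnomalousDissipation.AnomalousDissipation.Theorems.BaireStep

open Literature.Analysis.FunctionSpaces Literature.Analysis.FunctionSpaces.Torus
open Literature.Analysis.FluidPDE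
open Summit.AnomalousDissipation.AnomalousDissipation.Theses.BaireTransfer

/-! ## §1 The abstract Baire step -/

/-- **Baire–Osgood skeleton.** In a Baire space, if `U` is open and non-empty and every `interior (L j)`
(`j ∈ ℕ`) is dense in `U` (`U ⊆ closure (interior (L j))`), then some point of `U` lies in every `L j`:
the sets `D_j := interior (L j) ∪ (closure U)ᶜ` are open and dense, hence so is `⋂ⱼ D_j` in the sense that
it is dense, and a point of `U ∩ ⋂ⱼ D_j` cannot lie in `(closure U)ᶜ`. [folklore] -/
theorem baire_skeleton {X : Type*} [TopologicalSpace X] [BaireSpace X] {U : Set X} (hU : IsOpen U)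
    (hne : U.Nonempty) (L : ℕ → Set X) (hL : ∀ j, U ⊆ closure (interior (L j))) :
    ∃ c ∈ U, ∀ j, c ∈ L j := by
  -- the open dense sets `D_j`
  set D : ℕ → Set X := fun j => interior (L j) ∪ (closure U)ᶜ
  have hDo : ∀ j, IsOpen (D j) := fun j => isOpen_interior.union isClosed_closure.isOpen_compl
  have hDd : ∀ j, Dense (D j) := by
    intro j
    rw [dense_iff_inter_open]
    intro W hW hWne
    by_cases h : (W ∩ (closure U)ᶜ).Nonempty
    · obtain ⟨x, hxW, hx⟩ := h
      exact ⟨x, hxW, Or.inr hx⟩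
    · -- `W ⊆ closure U`, so the open set `W` meets `U`, and `W ∩ U ⊆ closure (interior (L j))`
      -- meets `interior (L j)`
      rw [Set.not_nonempty_iff_eq_empty] at h
      obtain ⟨x, hxW⟩ := hWne
      have hxU : x ∈ closure U := by
        by_contra hx
        have hx' : x ∈ W ∩ (closure U)ᶜ := ⟨hxW, hx⟩
        rw [h] at hx'
        exact hx'
      obtain ⟨y, hyW, hyU⟩ := mem_closure_iff.1 hxU W hW hxW
      obtain ⟨z, hzWU, hz⟩ := mem_closure_iff.1 (hL j hyU) (W ∩ U) (hW.inter hU) ⟨hyW, hyU⟩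
      exact ⟨z, hzWU.1, Or.inl hz⟩
  -- Baire: `⋂ⱼ D_j` is dense, so it meets the non-empty open set `U`
  have hdense : Dense (⋂ j, D j) := dense_iInter_of_isOpen_nat hDo hDd
  obtain ⟨c, hcU, hc⟩ := hdense.inter_open_nonempty U hU hne
  refine ⟨c, hcU, fun j => ?_⟩
  rcases Set.mem_iInter.1 hc j with h | h
  · exact interior_subset h
  · exact absurd (subset_closure hcU) h

/-! ## §2 Admissibility of the steady trigonometric-polynomial force `f_c` -/

/-- The Leray-projected coefficient family `k ↦ P_k (g k)` is transversal: `k · P_k v = 0` (for `k ≠ 0`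
the multiplier is `leraySym k`, `Torus.sum_mul_leraySym_apply`; the zero mode is killed,
`Torus.lerayCoeff_zero`). [folklore] -/
theorem isTransversal_lerayCoeff (S : Finset (Fin 3 → ℤ)) (g : (Fin 3 → ℤ) → EuclideanSpace ℂ (Fin 3)) :
    IsTransversal S (fun k => Torus.lerayCoeff k (g k)) := by
  intro k _
  show ∑ j, (k j : ℂ) * (Torus.lerayCoeff k (g k)) j = 0
  by_cases hk : k = 0
  · subst hk; simp
  · rw [Torus.lerayCoeff_of_ne_zero hk]; exact Torus.sum_mul_leraySym_apply k _

/-- The force `realTrigPoly S (k ↦ P_k (g k))` is divergence free. [folklore] -/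
theorem isDivFree_realTrigPoly_lerayCoeff (S : Finset (Fin 3 → ℤ))
    (g : (Fin 3 → ℤ) → EuclideanSpace ℂ (Fin 3)) :
    IsDivFree (realTrigPoly S (fun k => Torus.lerayCoeff k (g k))) :=
  isDivFree_realTrigPoly (isTransversal_lerayCoeff S g)

/-- The force `realTrigPoly S (k ↦ P_k (g k))` has zero mean: integrating termwise
(`Torus.integral_mFourier`), only the zero mode could contribute, and it is `P_0 (g 0) = 0`. [folklore] -/
theorem hasZeroMean_realTrigPoly_lerayCoeff (S : Finset (Fin 3 → ℤ))
    (g : (Fin 3 → ℤ) → EuclideanSpace ℂ (Fin 3)) :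
    HasZeroMean (realTrigPoly S (fun k => Torus.lerayCoeff k (g k))) := by
  set G : (Fin 3 → ℤ) → EuclideanSpace ℂ (Fin 3) := fun k => Torus.lerayCoeff k (g k) with hG
  show ∫ x, EuclideanSpace.realPart (trigPoly S G x) = 0
  rw [EuclideanSpace.realPart.integral_comp_comm (continuous_trigPoly S G).integrable_unitAddTorus]
  have h : ∫ x, trigPoly S G x = 0 := by
    simp_rw [trigPoly_apply]
    rw [integral_finsetSum S (f := fun k x => UnitAddTorus.mFourier k x • G k) fun k _ =>
      ((UnitAddTorus.mFourier k).continuous.smul continuous_const).integrable_unitAddTorus]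
    refine Finset.sum_eq_zero fun k _ => ?_
    rw [integral_smul_const, integral_mFourier]
    by_cases hk : k = 0
    · subst hk; simp [hG]
    · simp [hk]
  rw [h, map_zero]

/-! ## §3 The item -/

/-- **Settles stmt-AnomalousDissipation-1148** (`BaireTransfer.BaireStep`): the Baire target of route
BaireTransfer implies the thesis of route CoherentStates verbatim — one FIXED steady smooth divergence-free
mean-zero force `f_c` carrying bounded, loud, time-periodic classical NS solutions along `ν_j → 0`.
Proof: `baire_skeleton` on the Baire space `↥S → ℂ³` gives `c ∈ U ∩ ⋂ⱼ LOUD_j`; the witnesses are read off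
by choice; admissibility of `f_c` is §2; `ν_j → 0` because `0 < ν_j < 1/(j+1)`. [folklore] -/
theorem baireStep_proof : _root_.Summit.AnomalousDissipation.AnomalousDissipation.Theses.BaireTransfer.BaireStep := by
  unfold Summit.AnomalousDissipation.AnomalousDissipation.Theses.BaireTransfer.BaireStep
  rintro ⟨S, E, ε, hε, U, hU, hne, hLoud⟩
  -- one coefficient vector loud at every level
  obtain ⟨c, -, hc⟩ := baire_skeleton hU hne _ hLoud
  simp only [Set.mem_setOf_eq] at hc
  choose ν hν hνj τ u p hτ hsol hper hE hεj using hc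
  refine ⟨realTrigPoly S (fun k => Torus.lerayCoeff k (coeffExt S c k)), isSmooth_realTrigPoly S _,
    isDivFree_realTrigPoly_lerayCoeff S _, hasZeroMean_realTrigPoly_lerayCoeff S _, ν, τ, u, p, hν, ?_,
    fun j => ⟨hsol j, hτ j, hper j⟩, ⟨E, hE⟩, ε, hε, hεj⟩
  -- `ν_j → 0` by squeezing between `0` and `1/(j+1)`
  exact squeeze_zero (fun j => (hν j).le) (fun j => (hνj j).le) tendsto_one_div_add_atTop_nhds_zero_nat

end Summit.AnomalousDissipation.AnomalousDissipation.Theorems.BaireStep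

end
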